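import Summits.BirchSwinnertonDyer.Rank1Residual.X2.LocalInertiaCohomologyMultiplicative
import Summits.BirchSwinnertonDyer.BirchSwinnertonDyer.Theorems.CumulativeHeegnerLeopoldtEisensteinCharacterInvariantsAtThreeCurveRelaxationCount
import Summits.BirchSwinnertonDyer.BirchSwinnertonDyer.Theorems.UniversalToricDescentUnramifiedLocalCount
import Literature.NumberTheory.GaloisCohomology.LocalZpTowerH1Divisible
import HarnessLib

/-!
# Greenberg–Vatsal Prop. (2.4) at a MULTIPLICATIVE place `v ∤ p`, LOWER-bound half:
# `corank_{ℤ_p} H¹(K_{∞,w}, E[p^∞]) ≥ 1` when `a_v ≡ Nv (mod p)` (`v` finitely decomposed in the `ℤ_p`-tower, `p` odd)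

Route `CumulativeHeegnerLeopoldt`, crux K2-odd stmt-23970, line `birth`, stub ALG-≥(ii) `stub_curveLocalCorankGe` (lead
`bsd-line-chl-p1` g10; helper, `--supports stmt-BirchSwinnertonDyer-23970`). The tree holds the UPPER bound (`d_v ≤ 1`, and `= 0`
when `a_v ≢ Nv`: `X2.LocalInertiaCohomologyMultiplicative`, cell `b2b-bsdres`) and the character-module twin of the lower bound
(`CharLocalTameCount`, cell `bsd-eis`). THIS FILE proves the lower bound for the curve, from the same Tate datum
`C = Ψ(μ_{p^∞}) ⊂ A = E[p^∞]`, `D = A/C` (`GreenbergVatsalTateDatum.tateDatum`, twisted equivariance `σ•Ψ(u) = χ(σ)Ψ(σu)`,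
`χ(σ) = ±1` the sign of `σ` on `t = √γ`, inertia fixing `t`), at `Hi = Gal(K̄_v/K_{∞,w})` (`localSubgroup (ker κ) K_v`):

* §1 `exists_ne_zero_H1_gr` — `H¹(Hi, D) ≠ 0` when `p ∣ q_v − χ(φ)` (`φ` a Frobenius): `D` is an UNRAMIFIED line
  (`X2.GreenbergVatsalTateDatumSign`: `σ` acts as `χ(σ)`), so the tree's unramified count
  (`UniversalToricDescentUnramifiedLocalCount.exists_forall_natCard_subgroupH1_localSubgroup_eq`) gives
  `#H¹(Hi, D[p]) = #{b ∈ D[p] : φ^{p^R} b = q_v^{p^R} b} = #D[p] = p` (`χ(φ)^{p^R} = χ(φ)`, `q^{p^R} ≡ q`, `p ∣ q − χ(φ)`), and Kummer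
  (`KummerTorsionH1`, invariants `D` or `0`) gives `#H¹(Hi, D)[p] = p`;
* §2 `one_le_zpCorank_subgroupH1_localSubgroup` — `cd_p(Hi) ≤ 1` (`LocalZpTowerH1Divisible`) makes `H¹(Hi, A) → H¹(Hi, D)` ONTO
  (cohomology sequence of `0 → C → A → D → 0`, `H²(Hi, C) = 0`), so `H¹(Hi, A) ≠ 0`; being `p`-primary, `p`-divisible with finite
  `p`-torsion (`CurveRelaxationCount.finite_torsionBy_subgroupH1_localSubgroup_geomPrimaryTorsion`), `#H¹(Hi, A)[p] = p^{corank} ≥ 2`;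
* §3 `one_le_zpCorank_subgroupH1_inf_decomp` — the same in the global currency `H¹(ker κ ⊓ D_v, E[p^∞])`.

Tool theorems (no definition, no named fact, no `sorry`); the Tate parametrisation is explicit DATA (supplied at a multiplicative
place by the tree's proved Tate uniformisation in the consumer). BSD is not proved by any of this.
References: [GreenbergVatsal2000] §2 pp. 14–15, Prop. (2.4) p. 22 ("corank 𝓗_ℓ = s_ℓ d_ℓ"); [GreenbergLNM1716] §3 Lemma 3.3, §4 Lemma 4.5;
[SilvermanATAEC1994] V.3.1, V.5.2–5.4; [SerreGaloisCohomology1997] I §2.2, II §5.6; [Harari2020] Thm. 8.11 (a).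
-/

set_option autoImplicit false
-- `…BirchSwinnertonDyer.BirchSwinnertonDyer.Theorems…` is the problem's mandated namespace (D-0017).
set_option linter.dupNamespace false

noncomputable section

open scoped Classical AddSubgroup

open CategoryTheory Function NumberField IsDedekindDomain Field ValuativeRel WeierstrassCurve
  Literature.NumberTheory.EllipticCurves Literature.NumberTheory.EllipticCurves.GreenbergSelmer
  Literature.NumberTheory.GaloisRepresentations
  Literature.NumberTheory.GaloisRepresentations.IsNonarchimedeanLocalField
  IsDedekindDomain.HeightOneSpectrum
  Summit.BirchSwinnertonDyer.Rank1Residual Summit.BirchSwinnertonDyer.Rank1Residual.X2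
  Summit.BirchSwinnertonDyer.Rank1Residual.X2.GreenbergVatsalTateDatum
  Summit.BirchSwinnertonDyer.Rank1Residual.X2.GreenbergVatsalTateDatumSign
  Summit.BirchSwinnertonDyer.Rank1Residual.Iwasawa.NonsplitTower
  Summit.BirchSwinnertonDyer.BirchSwinnertonDyer.Theorems

universe u

namespace Summit.BirchSwinnertonDyer.BirchSwinnertonDyer.Theorems.CurveLocalTameCorank

variable {K : Type} [Field K] [NumberField K] (W : WeierstrassCurve K) [W.IsElliptic] (p : ℕ) [hp : Fact p.Prime]
  {v : HeightOneSpectrum (𝓞 K)}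
  (Ψ : Additive (AlgebraicClosure (v.adicCompletion K))ˣ →+ localPoints W (v.adicCompletion K))
  (t : AlgebraicClosure (v.adicCompletion K))
  (hΨσ : ∀ (σ : absoluteGaloisGroup (v.adicCompletion K))
      (u : (AlgebraicClosure (v.adicCompletion K))ˣ),
    σ • Ψ (Additive.ofMul u) =
      (if Field.absoluteGaloisGroup.toAlgEquiv (v.adicCompletion K) σ t = t then (1 : ℤ)
        else -1) •
      Ψ (Additive.ofMul (Units.map
        (Field.absoluteGaloisGroup.toAlgEquiv (v.adicCompletion K) σ :
          AlgebraicClosure (v.adicCompletion K) →* AlgebraicClosure (v.adicCompletion K)) u)))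
  (hsurj : Function.Surjective Ψ) {q : v.adicCompletion K} (hq0 : q ≠ 0) (hq1 : Valued.v q < 1)
  (hker : ∀ u : (AlgebraicClosure (v.adicCompletion K))ˣ, Ψ (Additive.ofMul u) = 0 →
    ∃ a : ℤ, (u : AlgebraicClosure (v.adicCompletion K)) =
      algebraMap (v.adicCompletion K) (AlgebraicClosure (v.adicCompletion K)) q ^ a)
  (ht : ∀ σ ∈ absInertia (v.adicCompletion K),
    Field.absoluteGaloisGroup.toAlgEquiv (v.adicCompletion K) σ t = t)
  (hpv : ((p : ℕ) : 𝓞 K) ∉ v.asIdeal)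

/-! ## §1 `H¹(Hi, D) ≠ 0` for the unramified quotient `D = E[p^∞]/C` when `a_v ≡ q_v (mod p)` -/

include hsurj hq0 hq1 hker ht hpv in
/-- **`H¹(Hi, D)` has a non-zero class** (`Hi = Gal(K̄_v/K_{∞,w})`, `D = E[p^∞]/C` the Tate quotient with its `Γ_{K_v}`-action
through `D_v`, `p` odd, `v ∤ p` not split completely in `K_∞`, `φ` a Frobenius of `K_v` with `p ∣ q_v − χ(φ)`): `#H¹(Hi, D)[p] =
#H¹(Hi, D[p]) = #D[p] = p` — Kummer (`KummerTorsionH1.natCard_nsmul_eq_zero_discreteH1_eq`; the `Hi`-invariants of `D` are `D` or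
`0`, both `p`-divisible) and the unramified count (`exists_forall_natCard_subgroupH1_localSubgroup_eq`: every `b ∈ D[p]` satisfies
`φ^{p^R} b = χ(φ) b = q_v b = q_v^{p^R} b`). [cite: GreenbergVatsal2000, §2 Prop. (2.4) (proof, p. 22)]
[cite: KellerYin2024, Lemma 1.1.1 (arXiv:2402.12781v2 TeX L455–462)] -/
theorem exists_ne_zero_H1_gr (hp2 : p ≠ 2) (κ : ZpExtension K p)
    (hns : ∃ σ : absoluteGaloisGroup (v.adicCompletion K), σ ∉ localSubgroup κ.kerSubgroup (v.adicCompletion K))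
    {φ : absoluteGaloisGroup (v.adicCompletion K)} (hφ : IsFrobPow φ 1)
    (hcong : (p : ℤ) ∣ (residueFieldCard (v.adicCompletion K) : ℤ) -
      (if Field.absoluteGaloisGroup.toAlgEquiv (v.adicCompletion K) φ t = t then (1 : ℤ) else -1)) :
    letI : DistribMulAction (absoluteGaloisGroup (v.adicCompletion K)) (tateDatum W p Ψ (sign_disj W Ψ t hΨσ)).Gr :=
      DistribMulAction.compHom _ ((absGaloisRestrict K (v.adicCompletion K)).toMonoidHom.codRestrict (decomp (K := K) v)
        (fun σ ↦ ⟨σ, rfl⟩))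
    ∃ x : Literature.NumberTheory.EllipticCurves.subgroupH1 (localSubgroup κ.kerSubgroup (v.adicCompletion K))
        (tateDatum W p Ψ (sign_disj W Ψ t hΨσ)).Gr, x ≠ 0 := by
  set N := tateDatum W p Ψ (sign_disj W Ψ t hΨσ) with hN
  letI instD : DistribMulAction (absoluteGaloisGroup (v.adicCompletion K)) N.Gr :=
    DistribMulAction.compHom _ ((absGaloisRestrict K (v.adicCompletion K)).toMonoidHom.codRestrict (decomp (K := K) v)
        (fun σ ↦ ⟨σ, rfl⟩))
  let Fv := v.adicCompletion K
  let G : Type := absoluteGaloisGroup Fv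
  let Hi : Subgroup G := localSubgroup κ.kerSubgroup Fv
  -- the sign `s = χ(φ) = ±1`
  set s : ℤ := if Field.absoluteGaloisGroup.toAlgEquiv Fv φ t = t then (1 : ℤ) else -1 with hs
  have hs1 : s = 1 ∨ s = -1 := by
    rw [hs]; split_ifs
    · exact Or.inl rfl
    · exact Or.inr rfl
  -- how `σ ∈ Γ_{K_v}` acts on `D`
  have hact : ∀ (σ : G) (d : N.Gr), σ • d =
      (⟨absGaloisRestrict K Fv σ, ⟨σ, rfl⟩⟩ : decomp (K := K) v) • d := fun σ d ↦ rfl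
  have hsign : ∀ (σ : G) (d : N.Gr), σ • d =
      (if Field.absoluteGaloisGroup.toAlgEquiv Fv σ t = t then (1 : ℤ) else -1) • d := by
    intro σ d
    obtain ⟨m, rfl⟩ := N.grMk_surjective d
    rw [hact]
    exact smul_grMk_eq_sign_smul W p Ψ t hΨσ hsurj hker σ m
  have hfix : ∀ {σ : G}, Field.absoluteGaloisGroup.toAlgEquiv Fv σ t = t → ∀ d : N.Gr, σ • d = d := by
    intro σ hσ d
    rw [hsign, if_pos hσ, one_zsmul]
  have hflip : ∀ {σ : G}, Field.absoluteGaloisGroup.toAlgEquiv Fv σ t ≠ t → ∀ d : N.Gr, σ • d = -d := by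
    intro σ hσ d
    rw [hsign, if_neg hσ, neg_one_zsmul]
  -- continuity, primary, divisible
  have hcontD : ∀ d : N.Gr, Continuous fun g : G ↦ g • d := fun d ↦
    (continuous_smul_gr W p N d).comp ((absGaloisRestrict K Fv).continuous_toFun.subtype_mk _)
  have hcontHi : ∀ d : N.Gr, Continuous fun g : Hi ↦ g • d := fun d ↦ (hcontD d).comp continuous_subtype_val
  have hprimD : ∀ d : N.Gr, ∃ k : ℕ, p ^ k • d = 0 := primary_gr W p N
  have hdivD : ∀ d : N.Gr, ∃ d' : N.Gr, p • d' = d := divisible_gr W p N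
  -- `2 • d = 0 ⇒ d = 0` (`p` odd)
  have htwo : ∀ d : N.Gr, 2 • d = 0 → d = 0 := by
    intro d h2
    obtain ⟨k, hk⟩ := hprimD d
    rw [← GreenbergVatsalSelmerEquality.two_nsmul_half_eq (p := p) hp2 hp.out hk, ← mul_nsmul', mul_comm, mul_nsmul', h2,
      nsmul_zero]
  -- the invariants of `Hi` in `D` are `p`-divisible inside the invariants
  have hinv : ∀ d : N.Gr, (∀ g : Hi, g • d = d) → ∃ d' : N.Gr, (∀ g : Hi, g • d' = d') ∧ p • d' = d := by
    intro d hd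
    by_cases hex : ∃ g : Hi, Field.absoluteGaloisGroup.toAlgEquiv Fv (g : G) t ≠ t
    · obtain ⟨g, hg⟩ := hex
      have hd0 : d = 0 := by
        apply htwo
        have h1 : (g : G) • d = d := hd g
        rw [hflip hg] at h1
        rw [two_nsmul]
        nth_rewrite 1 [← h1]
        exact neg_add_cancel d
      exact ⟨0, fun g ↦ smul_zero _, by rw [hd0, nsmul_zero]⟩
    · push Not at hex
      obtain ⟨d', hd'⟩ := hdivD d
      exact ⟨d', fun g ↦ hfix (hex g) d', hd'⟩
  -- `B = D[p]`: finite of order `p`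
  let B : Type := ↥((N.Gr)[(p : ℤ)])
  have eB : B ≃ ↥(Submodule.torsionBy ℤ (W.geomPrimaryTorsion p ⧸ AddSubgroup.toIntSubmodule N.plus) (p : ℤ)) :=
    { toFun := fun x ↦ ⟨(x.1 : W.geomPrimaryTorsion p ⧸ AddSubgroup.toIntSubmodule N.plus), by
        rw [Submodule.mem_torsionBy_iff]
        have h := AddSubgroup.torsionBy.nsmul_iff.mp x.2
        rw [Nat.cast_smul_eq_nsmul]; exact h⟩
      invFun := fun y ↦ ⟨(y.1 : N.Gr), AddSubgroup.torsionBy.nsmul_iff.mpr (by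
        have h := (Submodule.mem_torsionBy_iff _ _).mp y.2
        rw [Nat.cast_smul_eq_nsmul] at h; exact h)⟩
      left_inv := fun x ↦ rfl
      right_inv := fun y ↦ rfl }
  haveI : Finite B := by
    haveI := LocalInertiaCohomologyMultiplicative.finite_torsionBy_quotient_plus W p Ψ t hΨσ hq0 hq1 hker
    exact Finite.of_equiv _ eB.symm
  have hBcard : Nat.card B = p := by
    rw [Nat.card_congr eB]
    exact LocalInertiaCohomologyMultiplicative.natCard_torsionBy_quotient_plus W p Ψ t hΨσ hq0 hq1 hker
  have hBp : ∀ b : B, p • b = 0 := fun b ↦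
    Subtype.ext (by
      rw [AddSubgroupClass.coe_nsmul, ZeroMemClass.coe_zero]
      exact AddSubgroup.torsionBy.nsmul_iff.mp b.2)
  have hB : ∃ k : ℕ, ∀ b : B, p ^ k • b = 0 := ⟨1, fun b ↦ by rw [pow_one]; exact hBp b⟩
  have hcontB : ∀ b : B, Continuous fun g : G ↦ g • b := fun b ↦ (hcontD (b : N.Gr)).subtype_mk _
  have hunr : ∀ σ ∈ absInertia Fv, ∀ b : B, σ • b = b := fun σ hσ b ↦
    Subtype.ext (by rw [AddSubgroup.torsionBy.coe_smul]; exact hfix (ht σ hσ) (b : N.Gr))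
  -- the unramified count
  obtain ⟨R₀, hR⟩ := UniversalToricDescentUnramifiedLocalCount.exists_forall_natCard_subgroupH1_localSubgroup_eq κ hpv hns hB hcontB hunr hφ
  have hcount : Nat.card (Literature.NumberTheory.EllipticCurves.subgroupH1 Hi B) = p := by
    rw [hR R₀ le_rfl]
    -- every `b ∈ D[p]` satisfies `φ^{p^R₀} • b = q^{p^R₀} • b`
    have hz : ∀ (σ : G) (z : ℤ) (d : N.Gr), σ • (z • d) = z • (σ • d) := fun σ z d ↦
      map_zsmul (DistribSMul.toAddMonoidHom N.Gr σ) z d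
    have hpow : ∀ (n : ℕ) (d : N.Gr), φ ^ n • d = (s ^ n) • d := by
      intro n d
      induction n with
      | zero => rw [pow_zero, pow_zero, one_smul, one_zsmul]
      | succ n ih =>
        rw [pow_succ', mul_smul, ih, hz, hsign φ, ← hs, smul_smul, ← pow_succ]
    have hodd : Odd (p ^ R₀) := (hp.out.odd_of_ne_two hp2).pow
    have hspow : s ^ p ^ R₀ = s := by
      rcases hs1 with h | h
      · rw [h, one_pow]
      · rw [h, hodd.neg_one_pow]
    have hall : ∀ b : B, φ ^ p ^ R₀ • b = residueFieldCard Fv ^ p ^ R₀ • b := by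
      intro b
      have hbD : p • (b : N.Gr) = 0 := by
        have := hBp b
        rwa [Subtype.ext_iff, AddSubgroupClass.coe_nsmul, ZeroMemClass.coe_zero] at this
      -- `q^{p^R₀} • b = q • b`
      have hq : (residueFieldCard Fv ^ p ^ R₀) • (b : N.Gr) = residueFieldCard Fv • (b : N.Gr) := by
        refine CharLocalTameCount.nsmul_eq_nsmul_of_modEq (p := p) hbD ?_
        rw [← ZMod.natCast_eq_natCast_iff, Nat.cast_pow, ZMod.pow_card_pow]
      -- `s • b = q • b` (`p ∣ q − s`, `p • b = 0`)
      have hsq : s • (b : N.Gr) = (residueFieldCard Fv : ℤ) • (b : N.Gr) := by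
        obtain ⟨c, hc⟩ := hcong
        have h0 : ((residueFieldCard Fv : ℤ) - s) • (b : N.Gr) = 0 := by
          rw [hc, mul_comm, mul_zsmul, natCast_zsmul, hbD, zsmul_zero]
        rw [sub_smul, sub_eq_zero] at h0
        exact h0.symm
      apply Subtype.ext
      rw [AddSubgroup.torsionBy.coe_smul, AddSubgroupClass.coe_nsmul, hpow, hspow, hsq, natCast_zsmul, hq]
    rw [Nat.card_congr (Equiv.subtypeUnivEquiv hall), hBcard]
  -- Kummer
  have hK := KummerTorsionH1.natCard_nsmul_eq_zero_discreteH1_eq (Γ := Hi) (M := N.Gr) p hcontHi hdivD hinv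
  have hKp : Nat.card {x : Literature.NumberTheory.EllipticCurves.subgroupH1 Hi N.Gr // p • x = 0} = p := hK.trans hcount
  -- a non-zero class
  by_contra hall
  push Not at hall
  haveI : Subsingleton {x : Literature.NumberTheory.EllipticCurves.subgroupH1 Hi N.Gr // p • x = 0} :=
    ⟨fun a b ↦ Subtype.ext ((hall a.1).trans (hall b.1).symm)⟩
  have h1 : Nat.card {x : Literature.NumberTheory.EllipticCurves.subgroupH1 Hi N.Gr // p • x = 0} = 1 :=
    Nat.card_of_subsingleton ⟨0, smul_zero _⟩
  exact hp.out.one_lt.ne' (hKp.symm.trans h1)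

/-! ## §2 `corank_{ℤ_p} H¹(Hi, E[p^∞]) ≥ 1` -/

include Ψ t hΨσ hsurj hq0 hq1 hker ht hpv in
/-- **Greenberg–Vatsal Prop. (2.4), lower bound, local currency: `1 ≤ corank_{ℤ_p} H¹(Hi, E[p^∞])`** at a multiplicative `v ∤ p`
(Tate data `Ψ, t, q`, inertia fixing `t`), `p` odd, `v` finitely decomposed in the `ℤ_p`-extension `κ` (`Hi = (ker κ)_v`), `φ` a
Frobenius of `K_v` with `p ∣ q_v − χ(φ)` («`a_v ≡ Nv`»): the cohomology sequence of `0 → C → E[p^∞] → D → 0` over `Hi`, whose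
`H²(Hi, C)` vanishes (`cd_p(Hi) ≤ 1`), maps `H¹(Hi, E[p^∞])` ONTO `H¹(Hi, D) ≠ 0` (§1); and `H¹(Hi, E[p^∞])` is `p`-primary,
`p`-divisible with finite `p`-torsion, so `#H¹(Hi, E[p^∞])[p] = p^{corank} ≥ 2`.
[cite: GreenbergVatsal2000, §2 Prop. (2.4) (p. 22), pp. 14–15] [cite: GreenbergLNM1716, §4 Lemma 4.5] [cite: Harari2020, Thm. 8.11 (a)] -/
theorem one_le_zpCorank_subgroupH1_localSubgroup (hp2 : p ≠ 2) (κ : ZpExtension K p)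
    (hD : ¬ (decomp v ≤ κ.kerSubgroup))
    {φ : absoluteGaloisGroup (v.adicCompletion K)} (hφ : IsFrobPow φ 1)
    (hcong : (p : ℤ) ∣ (residueFieldCard (v.adicCompletion K) : ℤ) -
      (if Field.absoluteGaloisGroup.toAlgEquiv (v.adicCompletion K) φ t = t then (1 : ℤ) else -1)) :
    letI : DistribMulAction (absoluteGaloisGroup (v.adicCompletion K)) (W.geomPrimaryTorsion p) :=
      DistribMulAction.compHom _ (absGaloisRestrict K (v.adicCompletion K)).toMonoidHom
    1 ≤ zpCorank (Literature.NumberTheory.EllipticCurves.subgroupH1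
      (localSubgroup κ.kerSubgroup (v.adicCompletion K)) (W.geomPrimaryTorsion p)) p := by
  let N := tateDatum W p Ψ (sign_disj W Ψ t hΨσ)
  let M := W.geomPrimaryTorsion p
  letI instM : DistribMulAction (absoluteGaloisGroup (v.adicCompletion K)) M :=
    DistribMulAction.compHom _ (absGaloisRestrict K (v.adicCompletion K)).toMonoidHom
  letI instD : DistribMulAction (absoluteGaloisGroup (v.adicCompletion K)) N.Gr :=
    DistribMulAction.compHom _ ((absGaloisRestrict K (v.adicCompletion K)).toMonoidHom.codRestrict (decomp (K := K) v)
      (fun σ ↦ ⟨σ, rfl⟩))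
  let Fv := v.adicCompletion K
  let G : Type := absoluteGaloisGroup Fv
  let Hi : Subgroup G := localSubgroup κ.kerSubgroup Fv
  let X : Type := Literature.NumberTheory.EllipticCurves.subgroupH1 Hi M
  haveI : CompactSpace G := absoluteGaloisGroup_compactSpace Fv
  haveI : CompactSpace Hi := Literature.NumberTheory.GaloisCohomology.compactSpace_localSubgroup_kerSubgroup κ v
  have hns : ∃ σ : G, σ ∉ Hi := CharLocalTameCorank.exists_not_mem_localSubgroup_of_not_decomp_le κ hD
  -- module facts for `M = E[p^∞]` and `D`
  have hstab : ∀ m : M, IsOpen (MulAction.stabilizer (absoluteGaloisGroup K) m : Set (absoluteGaloisGroup K)) :=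
    fun m ↦ X11b.LocBridge.isOpen_stabilizer_geomPrimaryTorsion W p m
  have hcontK : ∀ m : M, Continuous fun σ : absoluteGaloisGroup K ↦ σ • m := fun m ↦
    continuous_smul_of_isOpen_stabilizer m (hstab m)
  have hcontM : ∀ m : M, Continuous fun g : G ↦ g • m := fun m ↦
    (hcontK m).comp (absGaloisRestrict K Fv).continuous_toFun
  have hcontHiM : ∀ m : M, Continuous fun g : Hi ↦ g • m := fun m ↦ (hcontM m).comp continuous_subtype_val
  have htorM : ∀ m : M, ∃ k : ℕ, p ^ k • m = 0 := LocalInertiaCohomologyMultiplicative.primary_curve W p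
  have hdivM : ∀ m : M, ∃ m' : M, p • m' = m := GreenbergVatsalTorsionCurve.divisible_curve W p
  have hcontD : ∀ d : N.Gr, Continuous fun g : G ↦ g • d := fun d ↦
    (continuous_smul_gr W p N d).comp ((absGaloisRestrict K Fv).continuous_toFun.subtype_mk _)
  have hcontHiD : ∀ d : N.Gr, Continuous fun g : Hi ↦ g • d := fun d ↦ (hcontD d).comp continuous_subtype_val
  -- the three `Hi`-representations and the short exact sequence `0 → C → M → D → 0`
  let ρ : ContinuousRep Hi ℤ M :=
    { toRepresentation := (discreteContRep Hi M).toRepresentation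
      continuous_smul := continuous_prod_of_discrete_right.mpr hcontHiM }
  let C : Submodule ℤ M := AddSubgroup.toIntSubmodule N.plus
  have hC : ∀ g : Hi, C ≤ C.comap (ρ g) := fun g m hm ↦ N.smul_mem (g : G) hm
  let ρ₁ : ContinuousRep Hi ℤ C := ρ.subrepresentation C hC
  let ρQ : ContinuousRep Hi ℤ N.Gr :=
    { toRepresentation := (discreteContRep Hi N.Gr).toRepresentation
      continuous_smul := continuous_prod_of_discrete_right.mpr hcontHiD }
  let ι : ρ₁.toTopRep ⟶ ρ.toTopRep :=
    TopRep.ofHom ⟨⟨C.subtype, continuous_subtype_val⟩, fun σ ↦ by ext m; rfl⟩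
  let π : ρ.toTopRep ⟶ ρQ.toTopRep :=
    TopRep.ofHom ⟨⟨N.grMk.toIntLinearMap, continuous_of_discreteTopology⟩, fun σ ↦ by ext m; rfl⟩
  have hSES : IsSES ι π :=
    { comp_eq_zero := by
        ext c
        change N.grMk ((c : C) : M) = 0
        have hc : ((c : C) : M) ∈ N.grMk.ker := by rw [N.ker_grMk]; exact c.2
        exact hc
      injective := Subtype.val_injective
      exact_mid := fun y hy ↦ by
        have hy' : y ∈ N.grMk.ker := hy
        rw [N.ker_grMk] at hy'
        exact ⟨⟨y, hy'⟩, rfl⟩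
      surjective := N.grMk_surjective }
  -- `H²(Hi, C) = 0` (`cd_p(Hi) ≤ 1`, `C` `p`-primary) ⇒ `H¹(Hi, M) → H¹(Hi, D)` onto
  have hcd : GroupCdLE Hi p 1 := Literature.NumberTheory.GaloisCohomology.groupCdLE_one_localSubgroup_kerSubgroup κ v hD
  have hCp : IsPrimaryTorsion p C := fun c ↦ by
    obtain ⟨k, hk⟩ := htorM (c : M)
    exact ⟨k, Subtype.ext (by rw [Submodule.coe_smul_of_tower, Submodule.coe_zero]; exact hk)⟩
  haveI h2 : Subsingleton (continuousCohomology 2 ρ₁.toTopRep) := hcd C ρ₁ hCp (by norm_num)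
  have hsurjH : ∀ z : continuousCohomology 1 ρQ.toTopRep, ∃ y : continuousCohomology 1 ρ.toTopRep,
      cohomologyMap π 1 y = z := fun z ↦ hSES.exists_map_one_eq_of_δ₁_eq_zero z (Subsingleton.elim _ _)
  -- `H¹(Hi, M) ≠ 0`
  obtain ⟨x, hx⟩ := exists_ne_zero_H1_gr W p Ψ t hΨσ hsurj hq0 hq1 hker ht hpv hp2 κ hns hφ hcong
  obtain ⟨y, hy⟩ := hsurjH x
  have hy0 : y ≠ 0 := by
    rintro h
    apply hx
    rw [← hy, h]
    exact map_zero _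
  obtain ⟨w, hw0⟩ : ∃ w : X, w ≠ 0 := ⟨y, hy0⟩
  -- `X = H¹(Hi, M)`: `p`-primary, `p`-divisible, finite `p`-torsion
  have hXprim : ∀ a : X, ∃ n : ℕ, p ^ n • a = 0 := fun a ↦ by
    obtain ⟨c, rfl⟩ := oneCocycleClass_surjective _ a
    exact IwasawaDual.exists_pow_smul_oneCocycleClass_eq_zero c fun g ↦ htorM (c.1 g)
  have hXdiv : ∀ a : X, ∃ b : X, p • b = a :=
    Literature.NumberTheory.GaloisCohomology.exists_nsmul_eq_subgroupH1_localSubgroup κ v hD hcontM hdivM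
  haveI hXfin : Finite (X[(p : ℤ)]) :=
    CurveRelaxationCount.finite_torsionBy_subgroupH1_localSubgroup_geomPrimaryTorsion κ W hpv hns
  have hcard := GreenbergSelmerCountNonsplit.natCard_torsionBy_eq_pow_zpCorank_of_divisible p hXprim hXdiv
  -- a non-zero class killed by `p`
  have hex : ∃ k : ℕ, p ^ k • w = 0 := hXprim w
  have hk₀ : p ^ Nat.find hex • w = 0 := Nat.find_spec hex
  have hk₀pos : 0 < Nat.find hex := by
    rcases Nat.eq_zero_or_pos (Nat.find hex) with h | h
    · rw [h, pow_zero, one_nsmul] at hk₀; exact absurd hk₀ hw0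
    · exact h
  set z : X := p ^ (Nat.find hex - 1) • w with hz
  have hzne : z ≠ 0 := fun h ↦ Nat.find_min hex (Nat.sub_lt hk₀pos one_pos) h
  have hpz : p • z = 0 := by
    rw [hz, ← mul_nsmul', ← pow_succ', Nat.sub_add_cancel hk₀pos, hk₀]
  have hzmem : z ∈ X[(p : ℤ)] := AddSubgroup.torsionBy.nsmul_iff.mpr hpz
  -- `#X[p] = p ^ corank ≥ 2`
  have hnt : Nontrivial (X[(p : ℤ)]) := ⟨⟨⟨z, hzmem⟩, 0, fun h ↦ hzne (congrArg Subtype.val h)⟩⟩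
  have h1 : 1 < Nat.card (X[(p : ℤ)]) := Finite.one_lt_card_iff_nontrivial.mpr hnt
  rw [hcard] at h1
  by_contra hlt
  push Not at hlt
  rw [Nat.lt_one_iff.mp hlt, pow_zero] at h1
  exact lt_irrefl 1 h1

/-! ## §3 The global currency `H¹(ker κ ⊓ D_v, E[p^∞])` -/

include Ψ t hΨσ hsurj hq0 hq1 hker ht hpv in
/-- **`1 ≤ corank_{ℤ_p} H¹(ker κ ⊓ D_v, E[p^∞])`** at a multiplicative `v ∤ p` with `p ∣ q_v − χ(φ)` — §2 transported along
`H¹(ker κ ⊓ D_v, M) ≃+ H¹((ker κ)_v, M)` (`CharLocalTameCorank.zpCorank_subgroupH1_inf_decomp_eq`). This is the `≥` half of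
`corank 𝓗_w = d_w` at one place of `K_∞` above `w` (the `[Γ:Γ_w]` places are conjugate), complementing the tree's `≤`.
[cite: GreenbergVatsal2000, §2 Prop. (2.4) (p. 22)] [cite: NeukirchANT1999, Ch. II §9 Prop. (9.6)] -/
theorem one_le_zpCorank_subgroupH1_inf_decomp (hp2 : p ≠ 2) (κ : ZpExtension K p)
    (hD : ¬ (decomp v ≤ κ.kerSubgroup))
    {φ : absoluteGaloisGroup (v.adicCompletion K)} (hφ : IsFrobPow φ 1)
    (hcong : (p : ℤ) ∣ (residueFieldCard (v.adicCompletion K) : ℤ) -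
      (if Field.absoluteGaloisGroup.toAlgEquiv (v.adicCompletion K) φ t = t then (1 : ℤ) else -1)) :
    1 ≤ zpCorank (Literature.NumberTheory.EllipticCurves.subgroupH1 (κ.kerSubgroup ⊓ decomp v)
      (W.geomPrimaryTorsion p)) p := by
  rw [CharLocalTameCorank.zpCorank_subgroupH1_inf_decomp_eq κ.kerSubgroup (W.geomPrimaryTorsion p) v p]
  exact one_le_zpCorank_subgroupH1_localSubgroup W p Ψ t hΨσ hsurj hq0 hq1 hker ht hpv hp2 κ hD hφ hcong

end Summit.BirchSwinnertonDyer.BirchSwinnertonDyer.Theorems.CurveLocalTameCorank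

end
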